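import Summits.MatrixMultiplication.OmegaCensus.STPPSmallPatternKernelSearch122R
import Summits.MatrixMultiplication.OmegaCensus.STPPSmallPatternKernelProduct

/-!
# ω-census, `(1,2,2)^4` is infeasible in `ℤ/2 × ℤ/2 × ℤ/2 × ℤ/2 × ℤ/2` — pruned kernel search, part 1

HONEST FRAMING (pub-omega census; verbatim): lottery ticket; floor = certified bounds/negative ranges.
Census STRUCTURE bookkeeping of the STPP track (seat pub-omega-stpp-3, gen 25; STRUCTURE row B5, the threshold column
`T2(H) = max {k : (1,2,2)^k ⊆ H}`, lower side), not progress on `ω`: small patterns in small groups bound no exponent.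

Chunks of `STPP122Neg.search2r (prodGC 2 (prodGC 2 (prodGC 2 (prodGC 2 (zcode 2))))) 4` (`decide +kernel`, ≈ 80 s predicted): entries
`(y, c'₀, xb, xb2, XB, XC, PP)` = fixed start, exclusion masks on the codes of `b₁`, `b'₁`, and the forbidden
difference masks of the start's pair-class rank (`STPPSmallPatternKernelReflect122R.lean`); assembled in `STPPSmallPatternNone122K4Z2pow5.lean`.

References: H. Cohn, R. Kleinberg, B. Szegedy, C. Umans, FOCS 2005 (arXiv:math/0511460), Def. 5.1.
-/

set_option Elab.async false
set_option synthInstance.maxSize 8192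
set_option synthInstance.maxHeartbeats 800000

namespace Summit.MatrixMultiplication.OmegaCensus

namespace STPP122Neg

open STPP211Neg

/-- Pruned kernel search (min-flag normal form), `ℤ/2 × ℤ/2 × ℤ/2 × ℤ/2 × ℤ/2`, `k = 4`, start `(y, c'₀) = (1, 2)`: b₁ outside the searched codes (empty); b₁ = 4, b'₁ ∈ [5, 6, 7, 8, 9, 10, 11, 12, 13, 14]
(≈ 40 s predicted). -/
theorem P2_2_2_2_2k4r.x0 : search2r (prodGC 2 (prodGC 2 (prodGC 2 (prodGC 2 (zcode 2))))) 4
    [(1, 2, 4294967280, 0, 0, 0, 0),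
    (1, 2, 4294967279, 4294934528, 0, 0, 0)] = true := by
  decide +kernel

/-- Pruned kernel search (min-flag normal form), `ℤ/2 × ℤ/2 × ℤ/2 × ℤ/2 × ℤ/2`, `k = 4`, start `(y, c'₀) = (1, 2)`: b₁ = 4, b'₁ ∈ [15, 16, 17, 18, 19, 20, 21, 22, 23, 24, 25, 26, 27, 28, 29, 30]
(≈ 38 s predicted). -/
theorem P2_2_2_2_2k4r.x1 : search2r (prodGC 2 (prodGC 2 (prodGC 2 (prodGC 2 (zcode 2))))) 4
    [(1, 2, 4294967279, 2147516415, 0, 0, 0)] = true := by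
  decide +kernel

/-- Pruned kernel search (min-flag normal form), `ℤ/2 × ℤ/2 × ℤ/2 × ℤ/2 × ℤ/2`, `k = 4`, start `(y, c'₀) = (1, 2)`: b₁ = 4, b'₁ ∈ [31]
(≈ 2 s predicted). -/
theorem P2_2_2_2_2k4r.x2 : search2r (prodGC 2 (prodGC 2 (prodGC 2 (prodGC 2 (zcode 2))))) 4
    [(1, 2, 4294967279, 2147483647, 0, 0, 0)] = true := by
  decide +kernel

/-- Pruned kernel search (min-flag normal form), `ℤ/2 × ℤ/2 × ℤ/2 × ℤ/2 × ℤ/2`, `k = 4`, start `(y, c'₀) = (1, 1)`: invalid start (refuted by the literal tests at once)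
(≈ 0 s predicted). -/
theorem P2_2_2_2_2k4r.x3 : search2r (prodGC 2 (prodGC 2 (prodGC 2 (prodGC 2 (zcode 2))))) 4
    [(1, 1, 0, 0, 0, 0, 0)] = true := by
  decide +kernel

end STPP122Neg

end Summit.MatrixMultiplication.OmegaCensus
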